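import Summits.NavierStokesRegularity.OSWSelfSimilar.SheetNSLineTorusCascadeTailAggregate
import HarnessLib

/-!
# Viscous CLM on the torus (`a = 0`, `σ = 2`): the AGGREGATE TAIL INDUCTION — the family `A kλ^k` on all high modes from finitely
# many low-mode bounds entering only through two antidiagonal sums, and the blow-up / PDE read-outs for every `(ν, c)`

HONEST FRAMING (cell ns-blowup GROUP B «PROFILE SEARCH», zone Z3, row Z3-U addendum A-F2 of `HOME/profile/z3/CENSUS-Z3.md`;
human rulings D-0035/D-0074; Z3-TWIN lineage): **1-D MODEL (viscous Constantin–Lax–Majda equation `ω_t = ω Hω + ν ω_xx` on `𝕋`);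
ODE calculus on Fourier-coefficient families, kernel-checked; not Euler, not Navier–Stokes; «violates: none — MODEL».**

OBJECT: the sine-datum cascade `IsSineCascade ν c e`; continuation of `SheetNSLineTorusCascadeTailAggregate` (Duhamel window bound).
Write the low modes `j ≤ K₁` as `(A j + d_j) λ^j ≤ e_j` on `[T₁, T]` with a perturbation `d` (`d_0 = 0`, `d_j = 0` above `K₁`,
`−δ ≤ d_j ≤ Δ`). On the antidiagonal of `k > K₁` the comparison products expand as
`Σ (A i + d_i)(A j + d_j) = A²(k³−k)/6 + 2A(k Σd − Σ i d_i) + Σ d_i d_j ≥ A²(k³−k)/6 + 2A(kD₀ − D₁) − (k+1)δΔ =: Q(k)`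
(`aggregate_conv_lb`), so ONE cubic condition `p(k) = (1−ε)Q(k) − 2νAk³ ≥ 0` for `k ≥ K₁+1` (checked by its value at `K₁+1` and a
monotone increment, `aggregate_cubic_nonneg`) drives the induction over the telescoping windows `L/(νk(k−1))`:

* `tail_induction_aggregate` — **`A k λ^k ≤ e_k(t)` for every `k > K₁`, `t ∈ [T₁ + (L/ν)(1/K₁ − 1/k), T]`**; `family_lower_bound_at`;
* `unbounded_of_universal_family` — a universal-family tail bound `A k λ₁^k ≤ E_k` on `[T₂, T]` (`E = cascadeSolution 1 (sineDatum 1)`)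
  gives, for EVERY `ν > 0`, `c` with `λ₁ c ≥ ν` and EVERY sine cascade with parameters `(ν, c)`, unbounded coefficients at every
  `t ∈ [T₂/ν, T/ν]`; `horizon_lt_of_universal_family` (PDE level, via eng-3's `horizon_lt_of_cascade_unbounded`: no classical
  `2π`-periodic solution of the MODEL PDE from `−c sin x` with `λ₁ c ≥ ν` exists on `[0, T₂/ν]`); `datum_lt_of_classicalSolution_family`.
The surplus of one low mode pays for the deficit of another: no per-mode deficiency bookkeeping, no `ζ`. bears_on: LADDER-NS N5 / zone Z3
(row Z3-U) → N1 linear core. WHAT THIS IS NOT: not NS; no number certified by THIS file (instances supply the rationals); no definitions.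
-/

namespace Summit.NavierStokesRegularity.OSWSelfSimilar
namespace SheetNSLineTorusCascade

open Finset Real Set

variable {ν c : ℝ} {e : ℕ → ℝ → ℝ}

/-- **The cubic condition.** With `12ν ≤ (1−ε)A`, `p(K₁+1) ≥ 0` and the increment condition, `p(k) ≥ 0` for all `k ≥ K₁+1`, where
`p(k) = (1−ε)[A²(k³−k)/6 + 2A(kD₀ − D₁) − (k+1)δΔ] − 2νAk³`. [folklore] -/
theorem aggregate_cubic_nonneg {K₁ : ℕ} {A ε δ Δ D₀ D₁ ν : ℝ} (hA : 0 < A)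
    (h1 : 12 * ν ≤ (1 - ε) * A)
    (h2 : 0 ≤ (1 - ε) * (A ^ 2 * ((((K₁ : ℝ) + 1) ^ 3 - ((K₁ : ℝ) + 1)) / 6)
        + 2 * A * (((K₁ : ℝ) + 1) * D₀ - D₁) - (((K₁ : ℝ) + 1) + 1) * (δ * Δ))
        - 2 * ν * A * ((K₁ : ℝ) + 1) ^ 3)
    (h3 : 0 ≤ (3 * ((K₁ : ℝ) + 1) ^ 2 + 3 * ((K₁ : ℝ) + 1)) * ((1 - ε) * A ^ 2 / 6 - 2 * ν * A)
        + (1 - ε) * (2 * A * D₀ - δ * Δ) - 2 * ν * A) :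
    ∀ k : ℕ, K₁ + 1 ≤ k → 0 ≤ (1 - ε) * (A ^ 2 * (((k : ℝ) ^ 3 - k) / 6)
      + 2 * A * ((k : ℝ) * D₀ - D₁) - ((k : ℝ) + 1) * (δ * Δ)) - 2 * ν * A * (k : ℝ) ^ 3 := by
  have hcoef : 0 ≤ (1 - ε) * A ^ 2 / 6 - 2 * ν * A := by
    have : 12 * ν * A ≤ (1 - ε) * A * A := mul_le_mul_of_nonneg_right h1 hA.le
    nlinarith
  intro k hk
  induction k, hk using Nat.le_induction with
  | base => push_cast; linarith [h2]
  | succ n hn ih =>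
    have hn' : ((K₁ : ℝ) + 1) ≤ n := by exact_mod_cast hn
    have hn0 : (0 : ℝ) ≤ n := by positivity
    have hsq : 3 * ((K₁ : ℝ) + 1) ^ 2 + 3 * ((K₁ : ℝ) + 1) ≤ 3 * (n : ℝ) ^ 2 + 3 * n := by nlinarith
    have hprod := mul_le_mul_of_nonneg_right hsq hcoef
    have hincr : (1 - ε) * (A ^ 2 * ((((n + 1 : ℕ) : ℝ) ^ 3 - ((n + 1 : ℕ) : ℝ)) / 6)
        + 2 * A * (((n + 1 : ℕ) : ℝ) * D₀ - D₁) - (((n + 1 : ℕ) : ℝ) + 1) * (δ * Δ))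
        - 2 * ν * A * ((n + 1 : ℕ) : ℝ) ^ 3
        = ((1 - ε) * (A ^ 2 * (((n : ℝ) ^ 3 - n) / 6) + 2 * A * ((n : ℝ) * D₀ - D₁) - ((n : ℝ) + 1) * (δ * Δ))
          - 2 * ν * A * (n : ℝ) ^ 3)
          + ((3 * (n : ℝ) ^ 2 + 3 * n) * ((1 - ε) * A ^ 2 / 6 - 2 * ν * A)
          + (1 - ε) * (2 * A * D₀ - δ * Δ) - 2 * ν * A) := by
      push_cast; ring
    rw [hincr]
    linarith [ih, hprod, h3]

/-- **The aggregate convolution bound.** For `k > K₁`, a perturbation `d` vanishing above `K₁` with `−δ ≤ d_j ≤ Δ` (`δ, Δ ≥ 0`),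
`D₀ ≤ Σ_{j≤K₁} d_j`, `Σ_{j≤K₁} j d_j ≤ D₁` and `A ≥ 0`:
`A²(k³−k)/6 + 2A(kD₀ − D₁) − (k+1)δΔ ≤ Σ_{i+j=k} (A i + d_i)(A j + d_j)`. [new here — MODEL] -/
theorem aggregate_conv_lb {d : ℕ → ℝ} {K₁ k : ℕ} {A δ Δ D₀ D₁ : ℝ} (hA : 0 ≤ A) (hk : K₁ < k)
    (hdK : ∀ j, K₁ < j → d j = 0) (hδ : 0 ≤ δ) (hΔ : 0 ≤ Δ) (hdlo : ∀ j, -δ ≤ d j) (hdhi : ∀ j, d j ≤ Δ)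
    (hD₀ : D₀ ≤ ∑ j ∈ range (K₁ + 1), d j) (hD₁ : ∑ j ∈ range (K₁ + 1), (j : ℝ) * d j ≤ D₁) :
    A ^ 2 * (((k : ℝ) ^ 3 - k) / 6) + 2 * A * ((k : ℝ) * D₀ - D₁) - ((k : ℝ) + 1) * (δ * Δ)
      ≤ ∑ q ∈ antidiagonal k, (A * (q.1 : ℝ) + d q.1) * (A * (q.2 : ℝ) + d q.2) := by
  have hkpos : (0 : ℝ) ≤ k := by positivity
  have hexp : ∑ q ∈ antidiagonal k, (A * (q.1 : ℝ) + d q.1) * (A * (q.2 : ℝ) + d q.2)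
      = A ^ 2 * ∑ q ∈ antidiagonal k, (q.1 : ℝ) * (q.2 : ℝ)
        + A * (∑ q ∈ antidiagonal k, (q.2 : ℝ) * d q.1 + ∑ q ∈ antidiagonal k, (q.1 : ℝ) * d q.2)
        + ∑ q ∈ antidiagonal k, d q.1 * d q.2 := by
    rw [mul_sum, mul_add, mul_sum, mul_sum, ← sum_add_distrib, ← sum_add_distrib, ← sum_add_distrib]
    refine sum_congr rfl fun q _ => ?_; ring
  have hswap : ∑ q ∈ antidiagonal k, (q.1 : ℝ) * d q.2 = ∑ q ∈ antidiagonal k, (q.2 : ℝ) * d q.1 := by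
    rw [← Nat.sum_antidiagonal_swap]
    rfl
  have hsnd := antidiagonal_sum_snd_mul (d := d) hdK hk
  have hdd : -(((k : ℝ) + 1) * (δ * Δ)) ≤ ∑ q ∈ antidiagonal k, d q.1 * d q.2 := by
    have hterm : ∀ q ∈ antidiagonal k, -(δ * Δ) ≤ d q.1 * d q.2 :=
      fun q _ => mul_ge_neg_of_bounds hδ hΔ (hdlo _) (hdhi _) (hdlo _) (hdhi _)
    have h := sum_le_sum hterm
    rw [sum_const, Nat.card_antidiagonal, nsmul_eq_mul] at h
    push_cast at h
    linarith
  rw [hexp, hswap, hsnd, antidiagonal_sum_mul_cast]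
  have hsumd : (k : ℝ) * D₀ - D₁
      ≤ (k : ℝ) * ∑ i ∈ range (K₁ + 1), d i - ∑ i ∈ range (K₁ + 1), (i : ℝ) * d i := by
    have := mul_le_mul_of_nonneg_left hD₀ hkpos
    linarith
  have hA2 := mul_le_mul_of_nonneg_left hsumd hA
  linarith

/-- **THE AGGREGATE TAIL INDUCTION.** See the module docstring. Hypotheses: the perturbation `d` of the family `A jλ^j` on the modes
`j ≤ K₁` (vanishing above `K₁`, `−δ ≤ d_j ≤ Δ` with `δ ≥ 0`, keeping `A j + d_j ≥ 0`), the base domination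
`(A j + d_j)λ^j ≤ e_j` on `[T₁, T]` for `1 ≤ j ≤ K₁`, the aggregate sums `D₀ ≤ Σ d_j`, `Σ j d_j ≤ D₁`, `e^{−L} ≤ ε < 1`, and the
three rational conditions of `aggregate_cubic_nonneg`. Conclusion: `A k λ^k ≤ e_k(t)` for every `k > K₁` and
`t ∈ [T₁ + (L/ν)(1/K₁ − 1/k), T]`. [new here — MODEL] -/
theorem tail_induction_aggregate (he : IsSineCascade ν c e) (hν : 0 < ν) (hc : 0 ≤ c)
    {K₁ : ℕ} (hK₁ : 1 ≤ K₁) {A lam T₁ T L ε δ Δ D₀ D₁ : ℝ} (hA : 0 < A) (hlam : 0 < lam)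
    (hT₁ : 0 ≤ T₁) (hL : 0 < L) (hε : exp (-L) ≤ ε) (hε1 : ε < 1) (hδ : 0 ≤ δ)
    (d : ℕ → ℝ) (hd0 : d 0 = 0) (hdK : ∀ j, K₁ < j → d j = 0)
    (hdlo : ∀ j, -δ ≤ d j) (hdhi : ∀ j, d j ≤ Δ)
    (hpos : ∀ j, j ≤ K₁ → 0 ≤ A * (j : ℝ) + d j)
    (hbase : ∀ j, 1 ≤ j → j ≤ K₁ → ∀ s ∈ Icc T₁ T, (A * (j : ℝ) + d j) * lam ^ j ≤ e j s)
    (hD₀ : D₀ ≤ ∑ j ∈ range (K₁ + 1), d j) (hD₁ : ∑ j ∈ range (K₁ + 1), (j : ℝ) * d j ≤ D₁)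
    (h1 : 12 * ν ≤ (1 - ε) * A)
    (h2 : 0 ≤ (1 - ε) * (A ^ 2 * ((((K₁ : ℝ) + 1) ^ 3 - ((K₁ : ℝ) + 1)) / 6)
        + 2 * A * (((K₁ : ℝ) + 1) * D₀ - D₁) - (((K₁ : ℝ) + 1) + 1) * (δ * Δ))
        - 2 * ν * A * ((K₁ : ℝ) + 1) ^ 3)
    (h3 : 0 ≤ (3 * ((K₁ : ℝ) + 1) ^ 2 + 3 * ((K₁ : ℝ) + 1)) * ((1 - ε) * A ^ 2 / 6 - 2 * ν * A)
        + (1 - ε) * (2 * A * D₀ - δ * Δ) - 2 * ν * A) :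
    ∀ k : ℕ, K₁ < k → ∀ t ∈ Icc (T₁ + L / ν * (1 / (K₁ : ℝ) - 1 / (k : ℝ))) T,
      A * (k : ℝ) * lam ^ k ≤ e k t := by
  have hK₁pos : (0 : ℝ) < K₁ := by exact_mod_cast hK₁
  have h1ε : 0 < 1 - ε := by linarith
  have hΔ0 : 0 ≤ Δ := by have := hdhi 0; rw [hd0] at this; exact this
  have hν0 : ν ≠ 0 := hν.ne'
  have hp_nonneg := aggregate_cubic_nonneg (K₁ := K₁) hA h1 h2 h3
  -- window starts `β k = T₁ + (L/ν)(1/K₁ − 1/k)`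
  obtain ⟨β, hβ⟩ : ∃ β : ℕ → ℝ, ∀ k : ℕ, β k = T₁ + L / ν * (1 / (K₁ : ℝ) - 1 / (k : ℝ)) := ⟨_, fun _ => rfl⟩
  have hβK₁ : β K₁ = T₁ := by rw [hβ]; ring
  have hβmono : ∀ i k : ℕ, K₁ ≤ i → i ≤ k → β i ≤ β k := by
    intro i k hi hik
    have hipos : (0 : ℝ) < i := by exact_mod_cast (lt_of_lt_of_le (by omega : 0 < K₁) hi)
    have hik' : (i : ℝ) ≤ k := by exact_mod_cast hik
    rw [hβ, hβ]
    have hinv : 1 / (k : ℝ) ≤ 1 / (i : ℝ) := one_div_le_one_div_of_le hipos hik'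
    have hLν : 0 ≤ L / ν := div_nonneg hL.le hν.le
    have := mul_le_mul_of_nonneg_left hinv hLν
    linarith
  have hβge : ∀ k : ℕ, K₁ ≤ k → T₁ ≤ β k := by
    intro k hk; rw [← hβK₁]; exact hβmono K₁ k le_rfl hk
  -- the comparison vector
  obtain ⟨m, hm⟩ : ∃ m : ℕ → ℝ, ∀ i : ℕ, m i = (A * (i : ℝ) + d i) * lam ^ i := ⟨_, fun _ => rfl⟩
  have hm0 : m 0 = 0 := by rw [hm, hd0]; simp
  have hmnn : ∀ i, 0 ≤ m i := by
    intro i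
    rw [hm]
    refine mul_nonneg ?_ (pow_nonneg hlam.le _)
    rcases le_or_gt i K₁ with hiK | hiK
    · exact hpos i hiK
    · rw [hdK i hiK, add_zero]; positivity
  -- strong induction
  intro k
  induction k using Nat.strong_induction_on with
  | _ k ih =>
    intro hk t ht
    rw [← hβ k] at ht
    have hk1 : 1 ≤ k := by omega
    have hk2 : (2 : ℝ) ≤ k := by exact_mod_cast (show 2 ≤ k by omega)
    have hkpos : (0 : ℝ) < k := by linarith
    have hkm1pos : (0 : ℝ) < (k : ℝ) - 1 := by linarith
    have hKkm1 : K₁ ≤ k - 1 := by omega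
    have ht₀T₁ : T₁ ≤ β (k - 1) := hβge (k - 1) hKkm1
    have ht₀0 : 0 ≤ β (k - 1) := le_trans hT₁ ht₀T₁
    have hcast : ((k - 1 : ℕ) : ℝ) = (k : ℝ) - 1 := by
      rw [Nat.cast_sub hk1]; simp
    have hτ : β k = β (k - 1) + L / (ν * (k : ℝ) * ((k : ℝ) - 1)) := by
      rw [hβ, hβ, hcast]
      field_simp
      ring
    have hτpos : 0 < L / (ν * (k : ℝ) * ((k : ℝ) - 1)) := by positivity
    have hmf : ∀ s ∈ Icc (β (k - 1)) T, ∀ i, 1 ≤ i → i < k → m i ≤ e i s := by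
      intro s hs i hi1 hik
      rw [hm]
      rcases le_or_gt i K₁ with hiK | hiK
      · exact hbase i hi1 hiK s ⟨le_trans ht₀T₁ hs.1, hs.2⟩
      · rw [hdK i hiK, add_zero]
        have hβi : β i ≤ β (k - 1) := hβmono i (k - 1) hiK.le (by omega)
        have hsI : s ∈ Icc (T₁ + L / ν * (1 / (K₁ : ℝ) - 1 / (i : ℝ))) T := by
          rw [← hβ i]; exact ⟨le_trans hβi hs.1, hs.2⟩
        exact ih i hik hiK s hsI
    -- the aggregate lower bound `Q ≤ Σ (A i + d_i)(A j + d_j)` and `p k = (1 − ε) Q − 2νAk³ ≥ 0`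
    obtain ⟨Q, hQ⟩ : ∃ Q : ℝ, Q = A ^ 2 * (((k : ℝ) ^ 3 - k) / 6) + 2 * A * ((k : ℝ) * D₀ - D₁)
        - ((k : ℝ) + 1) * (δ * Δ) := ⟨_, rfl⟩
    have hQconv : Q ≤ ∑ q ∈ antidiagonal k, (A * (q.1 : ℝ) + d q.1) * (A * (q.2 : ℝ) + d q.2) := by
      rw [hQ]; exact aggregate_conv_lb hA.le hk hdK hδ hΔ0 hdlo hdhi hD₀ hD₁
    have hle : 2 * ν * A * (k : ℝ) ^ 3 ≤ (1 - ε) * Q := by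
      have := hp_nonneg k (by omega)
      rw [hQ]; linarith
    have hQpos : 0 ≤ Q := by
      by_contra hneg
      have hQ' : Q < 0 := lt_of_not_ge hneg
      have := mul_neg_of_pos_of_neg h1ε hQ'
      have h2' : 0 ≤ 2 * ν * A * (k : ℝ) ^ 3 := by positivity
      linarith
    have hconv : ∀ s ∈ Icc (β (k - 1)) T, lam ^ k * Q ≤ ∑ q ∈ antidiagonal k, e q.1 s * e q.2 s := by
      intro s hs
      refine le_trans ?_ (antidiagonal_conv_mono k hm0 (he.zero s) (fun i _ => hmnn i) (hmf s hs))
      have hmm : ∑ q ∈ antidiagonal k, m q.1 * m q.2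
          = lam ^ k * ∑ q ∈ antidiagonal k, (A * (q.1 : ℝ) + d q.1) * (A * (q.2 : ℝ) + d q.2) := by
        rw [mul_sum]
        refine sum_congr rfl fun q hq => ?_
        have hsum : q.1 + q.2 = k := mem_antidiagonal.mp hq
        rw [hm, hm, ← hsum, pow_add]; ring
      rw [hmm]
      exact mul_le_mul_of_nonneg_left hQconv (pow_nonneg hlam.le _)
    -- Duhamel on `[β (k−1), T]` with `Φ = ½ lam^k Q`
    have hΦ : ∀ s ∈ Icc (β (k - 1)) T,
        (1 / 2) * (lam ^ k * Q) ≤ (1 / 2) * ∑ q ∈ antidiagonal k, e q.1 s * e q.2 s :=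
      fun s hs => mul_le_mul_of_nonneg_left (hconv s hs) (by norm_num)
    have hdt : L / (ν * (k : ℝ) * ((k : ℝ) - 1)) ≤ t - β (k - 1) := by rw [hτ] at ht; linarith [ht.1]
    have htI : t ∈ Icc (β (k - 1)) T := ⟨by linarith, ht.2⟩
    have hduh := duhamel_window_lb he hν hc hk1 ht₀0 hΦ t htI
    -- accumulation factor `≥ 1 − ε`
    have hfac : 1 - ε ≤ 1 - exp (-(ν * (k : ℝ) ^ 2 * (t - β (k - 1)))) := by
      have hxL : L ≤ ν * (k : ℝ) ^ 2 * (t - β (k - 1)) := by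
        have hpos : 0 < ν * (k : ℝ) * ((k : ℝ) - 1) := by positivity
        have hdt' := hdt
        rw [div_le_iff₀ hpos] at hdt'
        have h0 : 0 ≤ t - β (k - 1) := le_trans hτpos.le hdt
        have hid : ν * (k : ℝ) ^ 2 * (t - β (k - 1)) - (t - β (k - 1)) * (ν * (k : ℝ) * ((k : ℝ) - 1))
            = ν * (k : ℝ) * (t - β (k - 1)) := by ring
        have hnn : 0 ≤ ν * (k : ℝ) * (t - β (k - 1)) := by positivity
        linarith
      have := exp_le_exp.mpr (neg_le_neg hxL)
      linarith
    have hΦ0 : 0 ≤ (1 / 2) * (lam ^ k * Q) := by positivity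
    have hνk : 0 < ν * (k : ℝ) ^ 2 := by positivity
    calc A * (k : ℝ) * lam ^ k
        = (1 / 2) * (lam ^ k * (2 * ν * A * (k : ℝ) ^ 3)) / (ν * (k : ℝ) ^ 2) := by
          field_simp
      _ ≤ (1 / 2) * (lam ^ k * ((1 - ε) * Q)) / (ν * (k : ℝ) ^ 2) := by gcongr
      _ = (1 / 2) * (lam ^ k * Q) * (1 - ε) / (ν * (k : ℝ) ^ 2) := by ring
      _ ≤ (1 / 2) * (lam ^ k * Q) * (1 - exp (-(ν * (k : ℝ) ^ 2 * (t - β (k - 1))))) / (ν * (k : ℝ) ^ 2) := by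
          gcongr
      _ ≤ e k t := hduh

/-- **All high modes at once.** Under the hypotheses of `tail_induction_aggregate`: for every `t ∈ [T₁ + L/(νK₁), T]` and every
`k > K₁`, `A k λ^k ≤ e_k(t)`. [new here — MODEL] -/
theorem family_lower_bound_at (he : IsSineCascade ν c e) (hν : 0 < ν) (hc : 0 ≤ c)
    {K₁ : ℕ} (hK₁ : 1 ≤ K₁) {A lam T₁ T L ε δ Δ D₀ D₁ : ℝ} (hA : 0 < A) (hlam : 0 < lam)
    (hT₁ : 0 ≤ T₁) (hL : 0 < L) (hε : exp (-L) ≤ ε) (hε1 : ε < 1) (hδ : 0 ≤ δ)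
    (d : ℕ → ℝ) (hd0 : d 0 = 0) (hdK : ∀ j, K₁ < j → d j = 0)
    (hdlo : ∀ j, -δ ≤ d j) (hdhi : ∀ j, d j ≤ Δ)
    (hpos : ∀ j, j ≤ K₁ → 0 ≤ A * (j : ℝ) + d j)
    (hbase : ∀ j, 1 ≤ j → j ≤ K₁ → ∀ s ∈ Icc T₁ T, (A * (j : ℝ) + d j) * lam ^ j ≤ e j s)
    (hD₀ : D₀ ≤ ∑ j ∈ range (K₁ + 1), d j) (hD₁ : ∑ j ∈ range (K₁ + 1), (j : ℝ) * d j ≤ D₁)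
    (h1 : 12 * ν ≤ (1 - ε) * A)
    (h2 : 0 ≤ (1 - ε) * (A ^ 2 * ((((K₁ : ℝ) + 1) ^ 3 - ((K₁ : ℝ) + 1)) / 6)
        + 2 * A * (((K₁ : ℝ) + 1) * D₀ - D₁) - (((K₁ : ℝ) + 1) + 1) * (δ * Δ))
        - 2 * ν * A * ((K₁ : ℝ) + 1) ^ 3)
    (h3 : 0 ≤ (3 * ((K₁ : ℝ) + 1) ^ 2 + 3 * ((K₁ : ℝ) + 1)) * ((1 - ε) * A ^ 2 / 6 - 2 * ν * A)
        + (1 - ε) * (2 * A * D₀ - δ * Δ) - 2 * ν * A)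
    {t : ℝ} (ht : t ∈ Icc (T₁ + L / (ν * (K₁ : ℝ))) T) :
    ∀ k : ℕ, K₁ < k → A * (k : ℝ) * lam ^ k ≤ e k t := by
  intro k hk
  refine tail_induction_aggregate he hν hc hK₁ hA hlam hT₁ hL hε hε1 hδ d hd0 hdK hdlo hdhi hpos hbase hD₀ hD₁
    h1 h2 h3 k hk t ⟨?_, ht.2⟩
  have hK₁pos : (0 : ℝ) < K₁ := by exact_mod_cast hK₁
  have hkpos : (0 : ℝ) < k := by exact_mod_cast (lt_of_lt_of_le (by omega : 0 < K₁) hk.le)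
  have hν0 : ν ≠ 0 := hν.ne'
  have e1 : L / ν * (1 / (K₁ : ℝ) - 1 / (k : ℝ)) = L / (ν * (K₁ : ℝ)) - L / (ν * (k : ℝ)) := by
    field_simp
  have e2 : 0 ≤ L / (ν * (k : ℝ)) := by positivity
  linarith [ht.1]

/-! ### A rational accumulation factor for the far tail -/

/-- `e^{−n·log(b/a)} = (a/b)^n` for `a, b > 0` — the far-tail factor `e^{−L}` with `L = K₁ log(q_T/q_{T₁})` is rational.
[folklore] -/
theorem exp_neg_nat_mul_log_div (n : ℕ) {a b : ℝ} (ha : 0 < a) (hb : 0 < b) :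
    exp (-((n : ℝ) * Real.log (b / a))) = (a / b) ^ n := by
  have hlog : -((n : ℝ) * Real.log (b / a)) = (n : ℝ) * Real.log (a / b) := by
    rw [Real.log_div hb.ne' ha.ne', Real.log_div ha.ne' hb.ne']; ring
  rw [hlog, exp_nat_mul, exp_log (div_pos ha hb)]

/-- `log a + n·log(b/a)/n = log b` (`a, b > 0`, `n ≠ 0`): the telescoping far tail started at `T₁ = log a` with
`L = n log(b/a)` ends exactly at `T = log b`. [folklore] -/
theorem log_add_nat_mul_log_div_div {n : ℕ} (hn : n ≠ 0) {a b : ℝ} (ha : 0 < a) (hb : 0 < b) :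
    Real.log a + (n : ℝ) * Real.log (b / a) / (1 * (n : ℝ)) = Real.log b := by
  have hn' : (n : ℝ) ≠ 0 := by exact_mod_cast hn
  rw [Real.log_div hb.ne' ha.ne']
  field_simp
  ring

/-! ### From the universal family to every `(ν, c)` and to the PDE -/

/-- **BLOW-UP FOR EVERY `(ν, c)` WITH `λ₁ c ≥ ν` from a universal-family tail bound.** If `E = cascadeSolution 1 (sineDatum 1)`
satisfies `A k λ₁^k ≤ E_k(s)` for all `k > K₁` and `s ∈ [T₂, T]` (`A, λ₁ > 0`, `T₂ ≥ 0`), then for every `ν > 0`, every `c` with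
`ν ≤ λ₁ c` and EVERY sine cascade `e` with parameters `(ν, c)`: `k ↦ e_k(t)` is unbounded above at every `t ∈ [T₂/ν, T/ν]`
(`e_k(t) = ν (c/ν)^k E_k(νt) ≥ ν A k (λ₁c/ν)^k ≥ ν A k`). [new here — MODEL] -/
theorem unbounded_of_universal_family {K₁ : ℕ} {A lam₁ T₂ T : ℝ} (hA : 0 < A) (hlam₁ : 0 < lam₁) (hT₂ : 0 ≤ T₂)
    (hfam : ∀ k : ℕ, K₁ < k → ∀ s ∈ Icc T₂ T, A * (k : ℝ) * lam₁ ^ k ≤ cascadeSolution 1 (sineDatum 1) k s)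
    (hν : 0 < ν) (hc : ν ≤ lam₁ * c) (he : IsSineCascade ν c e)
    {t : ℝ} (ht : t ∈ Icc (T₂ / ν) (T / ν)) : ∀ M : ℝ, ∃ k : ℕ, M < e k t := by
  have hc0 : 0 ≤ c := by
    by_contra hneg
    have : lam₁ * c ≤ 0 := mul_nonpos_of_nonneg_of_nonpos hlam₁.le (le_of_lt (not_le.mp hneg))
    linarith
  have ht0 : 0 ≤ t := le_trans (div_nonneg hT₂ hν.le) ht.1
  have hs : ν * t ∈ Icc T₂ T := by
    constructor
    · have h1 := ht.1; rw [div_le_iff₀ hν] at h1; linarith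
    · have h2 := ht.2; rw [le_div_iff₀ hν] at h2; linarith
  have hratio : 1 ≤ lam₁ * c / ν := by rw [le_div_iff₀ hν, one_mul]; exact hc
  intro M
  obtain ⟨k, hk⟩ := exists_nat_gt (max (M / (ν * A)) (K₁ : ℝ))
  have hkM : M / (ν * A) < k := lt_of_le_of_lt (le_max_left _ _) hk
  have hkK : K₁ < k := by
    have : (K₁ : ℝ) < k := lt_of_le_of_lt (le_max_right _ _) hk
    exact_mod_cast this
  refine ⟨k, ?_⟩
  rw [he.eq_universal hν k t ht0]
  have hE := hfam k hkK (ν * t) hs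
  have hq : (1 : ℝ) ≤ (lam₁ * c / ν) ^ k := one_le_pow₀ hratio
  have hνA : 0 < ν * A := by positivity
  have hM : M < ν * A * (k : ℝ) := by rw [div_lt_iff₀ hνA] at hkM; linarith
  have hck : 0 ≤ (c / ν) ^ k := pow_nonneg (div_nonneg hc0 hν.le) k
  have hstep : ν * A * (k : ℝ) * (lam₁ * c / ν) ^ k
      ≤ ν * ((c / ν) ^ k * cascadeSolution 1 (sineDatum 1) k (ν * t)) := by
    have h := mul_le_mul_of_nonneg_left hE hck
    have hid : (c / ν) ^ k * (A * (k : ℝ) * lam₁ ^ k) = A * (k : ℝ) * (lam₁ * c / ν) ^ k := by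
      rw [show lam₁ * c / ν = lam₁ * (c / ν) by ring, mul_pow]; ring
    rw [hid] at h
    have := mul_le_mul_of_nonneg_left h hν.le
    linarith [this]
  have hlow : ν * A * (k : ℝ) ≤ ν * A * (k : ℝ) * (lam₁ * c / ν) ^ k := by
    have := mul_le_mul_of_nonneg_left hq (by positivity : (0 : ℝ) ≤ ν * A * (k : ℝ))
    linarith
  have hassoc : ν * ((c / ν) ^ k * cascadeSolution 1 (sineDatum 1) k (ν * t))
      = ν * (c / ν) ^ k * cascadeSolution 1 (sineDatum 1) k (ν * t) := by ring
  linarith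

/-- **PDE LEVEL.** Under the universal-family tail bound of `unbounded_of_universal_family` with `0 < T₂ ≤ T`: for every `ν > 0`
and every `c` with `ν ≤ λ₁ c`, every classical `2π`-periodic solution of the MODEL PDE `ω_t = ω·Hω + ν ω_xx` on `[0, T′]` with
`ω(0,·) = −c sin` has `T′ < T₂/ν` (eng-3's `horizon_lt_of_cascade_unbounded`). [new here — MODEL] -/
theorem horizon_lt_of_universal_family {T' : ℝ} {ω ωt ωx ωxx : ℝ → ℝ → ℝ}
    (h : IsClassicalSolution ν T' ω ωt ωx ωxx) (hω0 : ∀ x, ω 0 x = -c * Real.sin x)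
    {K₁ : ℕ} {A lam₁ T₂ T : ℝ} (hA : 0 < A) (hlam₁ : 0 < lam₁) (hT₂ : 0 < T₂) (hT : T₂ ≤ T)
    (hfam : ∀ k : ℕ, K₁ < k → ∀ s ∈ Icc T₂ T, A * (k : ℝ) * lam₁ ^ k ≤ cascadeSolution 1 (sineDatum 1) k s)
    (hν : 0 < ν) (hc : ν ≤ lam₁ * c) : T' < T₂ / ν := by
  have hτ : 0 < T₂ / ν := div_pos hT₂ hν
  exact horizon_lt_of_cascade_unbounded h hω0 hτ fun e he =>
    unbounded_of_universal_family hA hlam₁ hT₂.le hfam hν hc he ⟨le_rfl, div_le_div_of_nonneg_right hT hν.le⟩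

/-- **Contrapositive (census form).** Under the same universal-family tail bound: if a classical `2π`-periodic solution of the MODEL
PDE from `ω(0,·) = −c sin` exists on `[0, T′]` with `T₂/ν ≤ T′` (`ν > 0`), then `λ₁ c < ν`. [new here — MODEL] -/
theorem datum_lt_of_classicalSolution_family {T' : ℝ} {ω ωt ωx ωxx : ℝ → ℝ → ℝ}
    (h : IsClassicalSolution ν T' ω ωt ωx ωxx) (hω0 : ∀ x, ω 0 x = -c * Real.sin x)
    {K₁ : ℕ} {A lam₁ T₂ T : ℝ} (hA : 0 < A) (hlam₁ : 0 < lam₁) (hT₂ : 0 < T₂) (hT : T₂ ≤ T)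
    (hfam : ∀ k : ℕ, K₁ < k → ∀ s ∈ Icc T₂ T, A * (k : ℝ) * lam₁ ^ k ≤ cascadeSolution 1 (sineDatum 1) k s)
    (hν : 0 < ν) (hT' : T₂ / ν ≤ T') : lam₁ * c < ν := by
  by_contra hcon
  have hlt := horizon_lt_of_universal_family h hω0 hA hlam₁ hT₂ hT hfam hν (not_lt.mp hcon)
  exact absurd hT' (not_le.mpr hlt)

end SheetNSLineTorusCascade
end Summit.NavierStokesRegularity.OSWSelfSimilar
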